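import Summits.Ventures.HSemireg.WedgeHankelRecurrenceCompleteIntersection
import Summits.Ventures.HSemireg.WedgeHankelRecurrenceCompleteIntersectionTop
import Summits.Ventures.HSemireg.WedgeHankelRecurrenceWaringDichotomy

/-!
# Venture HSemireg — THE LINEAR COMPLEXITY OF A CLASS (shortest LFSR ∕ Massey 1969): the least `L` such that `q_0, …, q_N` satisfies a recurrence `q_{j+L} = Σ_{i<L} c_i q_{j+i}` (a member
# of `Rec_L(q)` of FULL degree `L`) is **`L = r` for an AFFINE class of middle rank `r`, `L = N + 2 − r` for a POLAR one (`2r ≤ N + 1`), and `L = t + 1` at the top rank of an even level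
# `N = 2t`**; MASSEY'S PROFILE: from level `N` to `N + 1` the linear complexity stays, except that an affine class whose generator the new coefficient breaks jumps to `N + 2 − L`; and every
# `t`-term sum of geometric sequences has `t ≥ L` (the node polynomial is a full-degree recurrence)

HONEST FRAMING. Part of the Lean index of the computation cell `pub-hsemireg` (seat p10 gen 30, Sunday typer «UNIFORM-IN-n»).
LINEAR ALGEBRA OF HANKEL (catalecticant) MATRICES and of polynomials over a field ONLY: no variety, no cohomology theory, no sheaf, no Ext group and no semiregularity map is constructed
here; nothing here says that HC / HC_CM / HC_AV holds; no Literature fact is declared or used.  Custodian versions as in `WedgeHankelSiegelIdeal` (1/3); the dictionary («linear complexity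
`L_N(q)` of the finite sequence `q_0 … q_N` = length of the shortest linear feedback shift register generating it; Massey, IEEE Trans. IT-15 (1969) Thms 1–2: `L_{N+1} = L_N` unless the
discrepancy is non-zero and `2L_N ≤ N + 1`, then `L_{N+1} = N + 2 − L_N`») is QUOTED in docstrings, never asserted — «`L` is the linear complexity» is expressed as `IsLeast` of the set
`{k | ∃ p ∈ Rec_k(q), p ≠ 0 ∧ deg p = k}` of LFSR lengths, no definition is introduced.

WHAT IS IN THE TREE.  N43 (`WedgeHankelRecurrenceClasses`, № 323): `IsAffineClass` (a full-degree generator of the minimal window), `IsPolarClass` (all generators of degree `< r`), the level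
transitions `IsAffineClass.isAffineClass_level_succ_iff`, `IsAffineClass.isPolarClass_level_succ_iff`, `IsPolarClass.rank_level_succ`, `IsPolarClass.isPolarClass_level_succ`,
`isAffineClass_level_succ_of_top`; N56 (№ 380) `exists_second_generator_of_isPolarClass` (a polar class has `g ∈ Rec_{N+2−r}(q)` of full degree `N + 2 − r`); N59 (№ 386) `exists_basis_recSpace_top`,
`recSpace_top_eq_bot`; N42 (№ 313) `rank_half_level_succ_of_not_mem`; N61 (№ 391) `prod_X_sub_C_mem_recSpace_of_secSeq_agree`; N19 (№ 174) `prod_X_sub_C_nodes_ne_zero`, `natDegree_prod_X_sub_C_nodes`; N18 (№ 173)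
`recSpace_eq_bot_of_lt`, `mem_recSpace_iff_exists_mul`, `X_mul_mem_recSpace_succ`, `recSpace_eq_degreeLT_of_lt`, `mem_degreeLT_succ_iff`, `natDegree_le_of_mem_recSpace`.  Mathlib: `Polynomial.natDegree_X_mul`,
`Polynomial.natDegree_mul`, `IsLeast`.
THIS FILE (namespace `Summit.Ventures.HSemireg.Wedge.HankelOuter` continued; PLAIN on N56 + N59 + N61; 0 definitions).  `S^N(q) := {k | ∃ p ∈ Rec^N_k(q), p ≠ 0 ∧ deg p = k}` (inline).
* §617 `succ_mem_setOf_lfsr` (`S^N(q)` is upward closed), `succ_level_mem_setOf_lfsr` (`N + 1 ∈ S^N(q)`), `rank_half_le_of_mem_setOf_lfsr` (`k ∈ S^N(q) ⇒ R^N(q) ≤ k`),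
  `mem_setOf_lfsr_of_secSeq_agree` (a `t`-term sum of geometric sequences with distinct nodes has `t ∈ S^N(q)`).
* §618 THE VALUE: **`isLeast_setOf_lfsr_of_isAffineClass`** (`L = r`), **`isLeast_setOf_lfsr_of_isPolarClass`** (`2r ≤ N + 1`: `L = N + 2 − r`), **`isLeast_setOf_lfsr_top`** (`R^{2t}(q) = t + 1`:
  `L = t + 1`); `le_of_isLeast_setOf_lfsr_of_secSeq_agree` (NUMBER OF TERMS `≥ L`).
* §619 MASSEY'S PROFILE (level `N → N + 1`): **`isLeast_setOf_lfsr_level_succ_of_mem`** (affine, generator continues: `L_{N+1} = r`), **`isLeast_setOf_lfsr_level_succ_of_not_mem`** (affine,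
  `2r ≤ N + 1`, generator broken: `L_{N+1} = N + 2 − r`, the jump), **`isLeast_setOf_lfsr_level_succ_of_isPolarClass`** (polar: `L_{N+1} = N + 2 − r = L_N`),
  **`isLeast_setOf_lfsr_level_succ_top`** (top of an even level: `L_{2t+1} = t + 1 = L_{2t}`).
READING: with N66 ∕ N68 (the number of TERMS over `k̄`) the two «lengths» of a class now sit side by side: both are `r` or `N + 2 − r`, the linear complexity deciding on AFFINE vs POLAR,
the number of terms on SEPARABLE-AFFINE vs the rest; they differ exactly for affine classes whose minimal recurrence has a repeated root.  Nothing Ext-side.  New names only.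
-/

open Module Polynomial
open scoped Matrix Polynomial

namespace Summit.Ventures.HSemireg.Wedge.HankelOuter

open Summit.Ventures.HSemireg.Wedge Summit.Ventures.HSemireg.Wedge.Hankel Summit.Ventures.HSemireg.Wedge.HankelSecant

variable (K : Type*) [Field K] {N : ℕ}

/-! ## §617. The set of LFSR lengths of a class -/

/-- **`S^N(q)` IS UPWARD CLOSED: a full-degree recurrence `p` of window `k + 1` gives the full-degree recurrence `X·p` of window `k + 2`.** -/
theorem succ_mem_setOf_lfsr {q : ℕ → K} {k : ℕ} (hk : k ∈ {k : ℕ | ∃ p ∈ recSpace K N q k, p ≠ 0 ∧ p.natDegree = k}) :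
    k + 1 ∈ {k : ℕ | ∃ p ∈ recSpace K N q k, p ≠ 0 ∧ p.natDegree = k} := by
  obtain ⟨p, hp, hp0, hpd⟩ := hk
  exact ⟨Polynomial.X * p, X_mul_mem_recSpace_succ K hp, mul_ne_zero Polynomial.X_ne_zero hp0, by rw [Polynomial.natDegree_X_mul hp0, hpd]⟩

/-- `k + j ∈ S^N(q)` for `k ∈ S^N(q)`. -/
theorem add_mem_setOf_lfsr {q : ℕ → K} {k : ℕ} (hk : k ∈ {k : ℕ | ∃ p ∈ recSpace K N q k, p ≠ 0 ∧ p.natDegree = k}) (j : ℕ) :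
    k + j ∈ {k : ℕ | ∃ p ∈ recSpace K N q k, p ≠ 0 ∧ p.natDegree = k} := by
  induction j with
  | zero => exact hk
  | succ j ih => exact succ_mem_setOf_lfsr K ih

/-- **`N + 1 ∈ S^N(q)`** (`X^{N+1}` is a recurrence of the empty window): the set of LFSR lengths is never empty. -/
theorem succ_level_mem_setOf_lfsr (q : ℕ → K) : N + 1 ∈ {k : ℕ | ∃ p ∈ recSpace K N q k, p ≠ 0 ∧ p.natDegree = k} :=
  ⟨Polynomial.X ^ (N + 1), by rw [recSpace_eq_degreeLT_of_lt K (Nat.lt_succ_self N), mem_degreeLT_succ_iff, Polynomial.natDegree_X_pow],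
    pow_ne_zero _ Polynomial.X_ne_zero, Polynomial.natDegree_X_pow (N + 1)⟩

/-- **EVERY LFSR LENGTH IS AT LEAST THE MIDDLE RANK: `k ∈ S^N(q) ⇒ R^N(q) ≤ k`** (`Rec_k(q) = 0` below the middle rank). -/
theorem rank_half_le_of_mem_setOf_lfsr {q : ℕ → K} {k : ℕ} (hk : k ∈ {k : ℕ | ∃ p ∈ recSpace K N q k, p ≠ 0 ∧ p.natDegree = k}) : (hankel1 K N (N / 2) q).rank ≤ k := by
  obtain ⟨p, hp, hp0, -⟩ := hk
  by_contra hlt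
  rw [recSpace_eq_bot_of_lt K rfl (show k < (hankel1 K N (N / 2) q).rank by omega), Submodule.mem_bot] at hp
  exact hp0 hp

/-- **A `t`-TERM SUM OF GEOMETRIC SEQUENCES HAS `t ∈ S^N(q)`**: its node polynomial `∏_{i<t} (X − λ_i)` is a full-degree recurrence of window `t + 1` (distinct nodes). -/
theorem mem_setOf_lfsr_of_secSeq_agree {t : ℕ} {lam A : Fin t → K} (hlam : Function.Injective lam) {q : ℕ → K} (hrep : ∀ j ≤ N, q j = secSeq K A lam j) :
    t ∈ {k : ℕ | ∃ p ∈ recSpace K N q k, p ≠ 0 ∧ p.natDegree = k} :=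
  ⟨∏ i, (Polynomial.X - Polynomial.C (lam i)), prod_X_sub_C_mem_recSpace_of_secSeq_agree K hlam hrep, prod_X_sub_C_nodes_ne_zero K lam, natDegree_prod_X_sub_C_nodes K lam⟩

/-! ## §618. The linear complexity: `r` for an affine class, `N + 2 − r` for a polar class, `t + 1` at the top -/

/-- **AN AFFINE CLASS OF MIDDLE RANK `r` HAS LINEAR COMPLEXITY `r`** (its full-degree generator is the shortest LFSR; nothing shorter than the middle rank exists). -/
theorem isLeast_setOf_lfsr_of_isAffineClass {r : ℕ} {q : ℕ → K} (hA : IsAffineClass K N r q) :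
    IsLeast {k : ℕ | ∃ p ∈ recSpace K N q k, p ≠ 0 ∧ p.natDegree = k} r := by
  obtain ⟨hq, m, hm, hm0, hmd⟩ := hA
  exact ⟨⟨m, hm, hm0, hmd⟩, fun k hk => hq ▸ rank_half_le_of_mem_setOf_lfsr K hk⟩

/-- **A POLAR CLASS OF MIDDLE RANK `r` (`2r ≤ N + 1`) HAS LINEAR COMPLEXITY `N + 2 − r`**: N56's second generator has full degree `N + 2 − r`, while for `k ≤ N + 1 − r` every member of
`Rec_k(q)` is `h·m` with `deg h ≤ k − r` (N18's window) and `deg m < r`, so of degree `< k`. -/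
theorem isLeast_setOf_lfsr_of_isPolarClass {r : ℕ} {q : ℕ → K} (hP : IsPolarClass K N r q) (h2 : r + r ≤ N + 1) :
    IsLeast {k : ℕ | ∃ p ∈ recSpace K N q k, p ≠ 0 ∧ p.natDegree = k} (N + 2 - r) := by
  obtain ⟨m, hm0, hspan⟩ := exists_recSpace_self_eq_span K hP.rank_eq h2
  have hm : m ∈ recSpace K N q r := by rw [hspan]; exact Submodule.mem_span_singleton_self m
  have hmr : m.natDegree < r := hP.2 m hm hm0
  obtain ⟨g, hg, hgd, -⟩ := exists_second_generator_of_isPolarClass K hP h2 hm hm0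
  refine ⟨⟨g, hg, fun h => by rw [h, Polynomial.natDegree_zero] at hgd; omega, hgd⟩, fun k hk => ?_⟩
  obtain ⟨p, hp, hp0, hpd⟩ := hk
  by_contra hlt
  have hrk : r ≤ k := hP.rank_eq ▸ rank_half_le_of_mem_setOf_lfsr K ⟨p, hp, hp0, hpd⟩
  obtain ⟨d, rfl⟩ := Nat.exists_eq_add_of_le hrk
  obtain ⟨h, hh, rfl⟩ := (mem_recSpace_iff_exists_mul K hP.rank_eq (by omega) hm hm0).mp hp
  have hh0 : h ≠ 0 := fun h0 => hp0 (by rw [h0, zero_mul])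
  rw [Polynomial.natDegree_mul hh0 hm0] at hpd
  have := (mem_degreeLT_succ_iff K).mp hh
  omega

/-- **A CLASS OF TOP RANK ON AN EVEN LEVEL (`R^{2t}(q) = t + 1`) HAS LINEAR COMPLEXITY `t + 1`** (N59: a generator of degree `t + 1`, and `Rec_k(q) = 0` for `k ≤ t`). -/
theorem isLeast_setOf_lfsr_top {t : ℕ} {q : ℕ → K} (hq : (hankel1 K (t + t) ((t + t) / 2) q).rank = t + 1) :
    IsLeast {k : ℕ | ∃ p ∈ recSpace K (t + t) q k, p ≠ 0 ∧ p.natDegree = k} (t + 1) := by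
  obtain ⟨-, g₂, -, -, -, hg₂, hg₂d, -⟩ := exists_basis_recSpace_top K hq
  exact ⟨⟨g₂, hg₂, fun h => by rw [h, Polynomial.natDegree_zero] at hg₂d; omega, hg₂d⟩, fun k hk => hq ▸ rank_half_le_of_mem_setOf_lfsr K hk⟩

/-- **THE NUMBER OF TERMS IS AT LEAST THE LINEAR COMPLEXITY: if `L` is the linear complexity of `q` on `[0, N]`, every representation `q_j = Σ_{i<t} A_i λ_i^j` (`j ≤ N`, distinct nodes) has
`t ≥ L`.** -/
theorem le_of_isLeast_setOf_lfsr_of_secSeq_agree {L t : ℕ} {q : ℕ → K} (hL : IsLeast {k : ℕ | ∃ p ∈ recSpace K N q k, p ≠ 0 ∧ p.natDegree = k} L) {lam A : Fin t → K}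
    (hlam : Function.Injective lam) (hrep : ∀ j ≤ N, q j = secSeq K A lam j) : L ≤ t :=
  hL.2 (mem_setOf_lfsr_of_secSeq_agree K hlam hrep)

/-! ## §619. Massey's profile: from level `N` to level `N + 1` -/

/-- **MASSEY (i): an AFFINE class of rank `r` whose full-degree generator `m` CONTINUES (`m ∈ Rec^{N+1}_r(q)`) keeps linear complexity `r` at level `N + 1`** (`2r ≤ N + 1`). -/
theorem isLeast_setOf_lfsr_level_succ_of_mem {r : ℕ} {q : ℕ → K} (hA : IsAffineClass K N r q) (h2 : r + r ≤ N + 1) {m : K[X]} (hm : m ∈ recSpace K N q r) (hm0 : m ≠ 0) (hmd : m.natDegree = r)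
    (hmem : m ∈ recSpace K (N + 1) q r) : IsLeast {k : ℕ | ∃ p ∈ recSpace K (N + 1) q k, p ≠ 0 ∧ p.natDegree = k} r :=
  isLeast_setOf_lfsr_of_isAffineClass K ((hA.isAffineClass_level_succ_iff h2 hm hm0 hmd).mpr hmem)

/-- **MASSEY (ii) — THE JUMP: an AFFINE class of rank `r` (`2r ≤ N + 1`) whose generator the new coefficient BREAKS (`m ∉ Rec^{N+1}_r(q)`) has linear complexity `N + 2 − r` at level
`N + 1`** (`2r ≤ N`: polar of rank `r + 1` at `N + 1`, N43; `2r = N + 1`: top rank `r + 1` of the even level `2r`, N42 + §618). -/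
theorem isLeast_setOf_lfsr_level_succ_of_not_mem {r : ℕ} {q : ℕ → K} (hA : IsAffineClass K N r q) (h2 : r + r ≤ N + 1) {m : K[X]} (hm : m ∈ recSpace K N q r) (hm0 : m ≠ 0)
    (hmd : m.natDegree = r) (hmem : m ∉ recSpace K (N + 1) q r) : IsLeast {k : ℕ | ∃ p ∈ recSpace K (N + 1) q k, p ≠ 0 ∧ p.natDegree = k} (N + 2 - r) := by
  rcases Nat.lt_or_ge (r + r) (N + 1) with hlt | hge
  · have hP : IsPolarClass K (N + 1) (r + 1) q := (hA.isPolarClass_level_succ_iff (by omega) hm hm0 hmd).mpr hmem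
    have h := isLeast_setOf_lfsr_of_isPolarClass K hP (by omega)
    rwa [show N + 1 + 2 - (r + 1) = N + 2 - r by omega] at h
  · have hN : N + 1 = r + r := by omega
    have hrk := rank_half_level_succ_of_not_mem K hA.rank_eq hm h2 hmem
    rw [hN] at hrk ⊢
    rw [show N + 2 - r = r + 1 by omega]
    exact isLeast_setOf_lfsr_top K hrk

/-- **MASSEY (iii): a POLAR class of rank `r` (`2r ≤ N + 1`) keeps its linear complexity `N + 2 − r` at level `N + 1`** (`2r ≤ N`: polar of rank `r + 1` at `N + 1`; `2r = N + 1`: top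
rank `r + 1` of the even level `2r`). -/
theorem isLeast_setOf_lfsr_level_succ_of_isPolarClass {r : ℕ} {q : ℕ → K} (hP : IsPolarClass K N r q) (h2 : r + r ≤ N + 1) :
    IsLeast {k : ℕ | ∃ p ∈ recSpace K (N + 1) q k, p ≠ 0 ∧ p.natDegree = k} (N + 2 - r) := by
  rcases Nat.lt_or_ge (r + r) (N + 1) with hlt | hge
  · have h := isLeast_setOf_lfsr_of_isPolarClass K (hP.isPolarClass_level_succ (by omega)) (by omega)
    rwa [show N + 1 + 2 - (r + 1) = N + 2 - r by omega] at h
  · have hN : N + 1 = r + r := by omega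
    have hrk := hP.rank_level_succ h2
    rw [hN] at hrk ⊢
    rw [show N + 2 - r = r + 1 by omega]
    exact isLeast_setOf_lfsr_top K hrk

/-- **MASSEY (iv): a class of TOP rank on the even level `2t` keeps linear complexity `t + 1` at level `2t + 1`** (it is affine of rank `t + 1` there, N43). -/
theorem isLeast_setOf_lfsr_level_succ_top {t : ℕ} {q : ℕ → K} (hq : (hankel1 K (2 * t) (2 * t / 2) q).rank = t + 1) :
    IsLeast {k : ℕ | ∃ p ∈ recSpace K (2 * t + 1) q k, p ≠ 0 ∧ p.natDegree = k} (t + 1) :=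
  isLeast_setOf_lfsr_of_isAffineClass K (isAffineClass_level_succ_of_top K hq)

end Summit.Ventures.HSemireg.Wedge.HankelOuter
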